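import Summits.BirchSwinnertonDyer.BirchSwinnertonDyer.Theorems.AlignedTransportAtTwoMainConjectureTransportAlignedAtTwoDeltaPosCongruenceLevelOfFacts
import Summits.BirchSwinnertonDyer.BirchSwinnertonDyer.Theorems.AlignedTransportAtTwoMainConjectureTransportAlignedAtTwoDeltaPosCongruenceOfFacts
import Summits.BirchSwinnertonDyer.BirchSwinnertonDyer.Theorems.AlignedTransportAtTwoMainConjectureTransportAlignedAtTwoOrdPlusLine
import Summits.BirchSwinnertonDyer.BirchSwinnertonDyer.Theorems.ResidualThetaTransportAtTwoThetaLayerLambdaCongruenceAtTwoHeckeAdjointTranspose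
import Literature.NumberTheory.EllipticCurves.ModularJacobianTorsionHeckeSelfDualProofs
import HarnessLib

/-!
# Crux C1 `MainConjectureTransportAlignedAtTwo` (stmt-BirchSwinnertonDyer-22296), line `birth`: THE HECKE SELF-DUALITY INPUT `hSD` IS A TREE THEOREM —
# the registered PRINT stub `stub_heckeSideAtTwo` shrinks to Buzzard's Prop. 2.4 alone, and the (R1) / Buzzard-locus `λ`-laws lose one named fact
# (width seat att-p4 g15; `--supports 22296`)

THEOREMS ONLY (no `def`, no `sorry`, no new named fact). BSD is not proved by this; C1 is not closed by this; no stub is discharged outright.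

The line's registered skeleton (v24.1, `Cruxes/MainConjectureTransportAlignedAtTwo/Lines/birth.lean`) carries the PRINT bundle
`stub_heckeSideAtTwo : heckeSelfDual_torsionBy_J0 ∧ buzzard2000_multiplicityOne_gamma0`, and the landed capstones of the `Δ(W₁) > 0` residual (R1)
(`…DeltaPosCongruenceLevelOfFacts.lamLawDeltaPos_of_facts`, p671200; `…DeltaPosCongruenceOfFacts.lamLawDeltaPos_of_conductorNorm_eq_of_facts`, p671167) and
of the rhombic Buzzard locus (`…OrdPlusLine.lamLaw_of_negDisc_of_not_padicSquare`, p657329) take `hSD : heckeSelfDual_torsionBy_J0` (Hecke self-duality of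
`J₀(N)[ℓ]`, Darmon–Diamond–Taylor Lemma 1.38) as a hypothesis. Since 2026-08-28 that statement is PROVED in the tree (cell bsd-wall, crux Kan⁺): the
kernel intersection pairing `…ThetaLayerLambdaCongruenceAtTwo.ip_of_crossingPairing_flagSides : periodHomology_exists_heckeSelfAdjoint_perfectPairing`
(file `…HeckeAdjointTranspose`, bricks HA1–HA8) fed to the Literature reduction `heckeSelfDual_torsionBy_J0_of_perfectPairing`
(`Literature/…/ModularJacobianTorsionHeckeSelfDualProofs.lean`); the composite is also recorded there as `…HeckeAdjointKanPlusOfBz.heckeSelfDual_torsionBy_J0_of_flagSides`.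
This file folds that theorem into the C1 line:

* `heckeSideAtTwo_of_bz hBz : heckeSelfDual_torsionBy_J0 ∧ buzzard2000_multiplicityOne_gamma0` — the TYPE of `stub_heckeSideAtTwo`, from Buzzard's
  Prop. 2.4 alone (so a v25.1 skeleton may register `stub_buzzardAtTwo : buzzard2000_multiplicityOne_gamma0` and keep every composition byte-identical
  through `heckeSideAtTwo_of_bz stub_buzzardAtTwo`);
* `lamLawBuzzardLocus_of_bz` — the `λ`-law on the rhombic non-Kilford cell (`Δ(W₁) < 0`, `Δ(W₁) ∉ ℚ₂²`) from Buzzard's Prop. 2.4 ALONE (p657329 with `hSD`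
  discharged), in the binder shape of the skeleton's `lamLawBuzzardLocus_of_stubs`;
* `lamLawDeltaPos_of_facts_of_bz` — the statement of `stub_lamLawDeltaPos` (R1) VERBATIM from FIVE tree-named PRINT facts (Buzzard 2.4, the plus period
  unit at `2`, modularity, Néron scaling, T1⁺ `nonempty_modularJacobianGaloisDataWithForms`) — p671200 with `hSD` discharged;
* `lamLawDeltaPos_of_conductorNorm_eq_of_facts_of_bz` — the equal-conductor twin (p671167 with `hSD` discharged; T1 `nonempty_modularJacobianGaloisData`).

References: Darmon–Diamond–Taylor 1995 §1.3, §1.6 Lemma 1.38, §4.5; Merel 1995 §1.2–1.3; Buzzard 2000 Prop. 2.4; Greenberg–Vatsal 2000 Thm. (1.4);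
Abbes–Ullmo 1996 Thm. A.
-/

noncomputable section

-- justification: the `Summit.BirchSwinnertonDyer.BirchSwinnertonDyer.…` path repeats a component (route-file convention)
set_option linter.dupNamespace false
set_option autoImplicit false

open scoped MatrixGroups ModularForm NumberField Classical
open CongruenceSubgroup Complex WeierstrassCurve IsDedekindDomain Polynomial Module
open Literature.NumberTheory.EllipticCurves Literature.NumberTheory.EllipticCurves.ModularForms
open Literature.NumberTheory.EllipticCurves.Greenberg1999 Literature.NumberTheory.EllipticCurves.GreenbergVatsal2000
open Summit.BirchSwinnertonDyer.Rank1Residual.F1Sign2 Summit.BirchSwinnertonDyer.Rank1Residual.X1.MuLambda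
open Summit.BirchSwinnertonDyer.BirchSwinnertonDyer.Theorems.ThetaLayerLambdaCongruenceAtTwo
open Summit.BirchSwinnertonDyer.BirchSwinnertonDyer.Theorems.AlignedTransportAtTwoDeltaPosCongruenceLevelOfFacts
open Summit.BirchSwinnertonDyer.BirchSwinnertonDyer.Theorems.AlignedTransportAtTwoDeltaPosCongruenceOfFacts
open Summit.BirchSwinnertonDyer.BirchSwinnertonDyer.Theorems.AlignedTransportAtTwoOrdPlusLine

namespace Summit.BirchSwinnertonDyer.BirchSwinnertonDyer.Theorems.AlignedTransportAtTwoSdFold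

/-- **The Hecke-side PRINT bundle of the C1 line from Buzzard's Prop. 2.4 alone**: the TYPE of the registered stub `stub_heckeSideAtTwo`
(`heckeSelfDual_torsionBy_J0 ∧ buzzard2000_multiplicityOne_gamma0`), the first conjunct being the tree theorem
`heckeSelfDual_torsionBy_J0_of_perfectPairing ip_of_crossingPairing_flagSides` (Hecke self-duality of `J₀(N)[ℓ]` from the kernel intersection pairing).
[cite: DarmonDiamondTaylor1995, §1.6 Lemma 1.38 and §4.5] [cite: Buzzard2000LevelLoweringModTwo, Prop. 2.4] -/
theorem heckeSideAtTwo_of_bz (hBz : buzzard2000_multiplicityOne_gamma0) :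
    heckeSelfDual_torsionBy_J0 ∧ buzzard2000_multiplicityOne_gamma0 :=
  ⟨heckeSelfDual_torsionBy_J0_of_perfectPairing ip_of_crossingPairing_flagSides, hBz⟩

/-- **The `λ`-law on the rhombic Buzzard locus (`Δ(W₁) < 0`, `Δ(W₁) ∉ ℚ₂²`) from Buzzard's Prop. 2.4 ALONE** — the lead's
`…OrdPlusLine.lamLaw_of_negDisc_of_not_padicSquare` (p657329) with its Hecke self-duality hypothesis discharged by the tree theorem, in the binder shape of the
skeleton's `lamLawBuzzardLocus_of_stubs` (the twist exclusion, `Δ ∉ ℚ²` and the two alignment binders are idle).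
[cite: Buzzard2000LevelLoweringModTwo, Prop. 2.4] [cite: GreenbergVatsal2000, Thm. (1.4) and §3] [cite: DarmonDiamondTaylor1995, §1.6 Lemma 1.38] -/
theorem lamLawBuzzardLocus_of_bz (hBz : buzzard2000_multiplicityOne_gamma0) :
    ∀ (W₁ : WeierstrassCurve ℚ) [W₁.IsElliptic] [W₁.IsGloballyMinimal]
      (W₂ : WeierstrassCurve ℚ) [W₂.IsElliptic] [W₂.IsGloballyMinimal],
      IsOrdinaryAt W₁ 2 → IsOrdinaryAt W₂ 2 →
      (∀ x : ℚ, ¬ HasRationalTwoTorsionX W₁ x) → (∀ x : ℚ, ¬ HasRationalTwoTorsionX W₂ x) →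
      ¬ IsSquare W₁.Δ → ¬ IsSquare W₂.Δ →
      (¬ ∃ (d : ℚ) (c : WeierstrassCurve.VariableChange ℚ), c • W₁.quadraticTwist d = W₂) →
      W₁.Δ < 0 → (∀ s : ℚ_[2], s ^ 2 ≠ (W₁.Δ : ℚ_[2])) →
      ∀ (F : Type) [Field F] [NumberField F], Module.finrank ℚ F = 3 →
      ∀ e₁ e₂ : F, aeval e₁ (twoDivisionUCubic W₁) = 0 → aeval e₂ (twoDivisionUCubic W₂) = 0 →
      AlignedAtTwo F e₁ e₂ → AlignedAtInfinity F (twoDivisionUCubic W₁) (twoDivisionUCubic W₂) e₁ e₂ →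
      ∀ [NeZero (W₁.conductorNorm ℤ)] [NeZero (W₂.conductorNorm ℤ)]
        (f₁ : CuspForm (Gamma0 (W₁.conductorNorm ℤ)) 2), IsNewformOf W₁ f₁ →
      ∀ (f₂ : CuspForm (Gamma0 (W₂.conductorNorm ℤ)) 2), IsNewformOf W₂ f₂ →
      ∀ G₁ G₂ : IwasawaAlgebra 2, IsEvenBranchLiftAtTwo W₁ f₁ G₁ → IsEvenBranchLiftAtTwo W₂ f₂ G₂ →
        lam G₁ + ∑ ℓ ∈ (W₁.conductorNorm ℤ * W₂.conductorNorm ℤ).primeFactors.erase 2, lambdaCorrectionAtTwo W₁ ℓ =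
          lam G₂ + ∑ ℓ ∈ (W₁.conductorNorm ℤ * W₂.conductorNorm ℤ).primeFactors.erase 2, lambdaCorrectionAtTwo W₂ ℓ :=
  fun W₁ _ _ W₂ _ _ hord₁ hord₂ ht₁ ht₂ _ _ _ hΔ hΔ₂ _F _ _ hF _e₁ _e₂ he₁ he₂ _ _ _ _ _f₁ hf₁ _f₂ hf₂ _G₁ _G₂ hG₁ hG₂ ↦
    lamLaw_of_negDisc_of_not_padicSquare (heckeSideAtTwo_of_bz hBz).1 hBz W₁ W₂ hord₁ hord₂ ht₁ ht₂ hΔ hΔ₂ hF he₁ he₂ hf₁ hf₂ hG₁ hG₂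

/-- **(R1) `stub_lamLawDeltaPos` — its statement VERBATIM — from FIVE tree-named PRINT facts** (Buzzard's multiplicity one off the Kilford stratum, the plus
period unit at `2`, modularity, Néron scaling, the `ℚ`-structure of `J₀(L)` with forms): att-p3 g14's `lamLawDeltaPos_of_facts` (p671200) with the Hecke
self-duality input supplied by the tree theorem. [cite: GreenbergVatsal2000, Thm. (1.4) and §3] [cite: Buzzard2000LevelLoweringModTwo, Prop. 2.4]
[cite: DarmonDiamondTaylor1995, §1.5 and §1.7, §1.6 Lemma 1.38] [cite: AbbesUllmo1996, Thm. A] -/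
theorem lamLawDeltaPos_of_facts_of_bz
    (hBz : buzzard2000_multiplicityOne_gamma0) (hΩu : realPeriodRat_eq_unit_mul_plusPeriod_two)
    (hmod : exists_isNewformOf) (hNS : integral_neronScaling_of_isGloballyMinimal) (hJ : nonempty_modularJacobianGaloisDataWithForms) :
    ∀ (W₁ : WeierstrassCurve ℚ) [W₁.IsElliptic] [W₁.IsGloballyMinimal]
      (W₂ : WeierstrassCurve ℚ) [W₂.IsElliptic] [W₂.IsGloballyMinimal],
      IsOrdinaryAt W₁ 2 → IsOrdinaryAt W₂ 2 →
      (∀ x : ℚ, ¬ HasRationalTwoTorsionX W₁ x) → (∀ x : ℚ, ¬ HasRationalTwoTorsionX W₂ x) →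
      ¬ IsSquare W₁.Δ → ¬ IsSquare W₂.Δ →
      (¬ ∃ (d : ℚ) (c : WeierstrassCurve.VariableChange ℚ), c • W₁.quadraticTwist d = W₂) →
      ¬ OnKilfordStratumAtTwo W₁ → 0 < W₁.Δ →
      ∀ (F : Type) [Field F] [NumberField F], Module.finrank ℚ F = 3 →
      ∀ e₁ e₂ : F, aeval e₁ (twoDivisionUCubic W₁) = 0 → aeval e₂ (twoDivisionUCubic W₂) = 0 →
      AlignedAtTwo F e₁ e₂ → AlignedAtInfinity F (twoDivisionUCubic W₁) (twoDivisionUCubic W₂) e₁ e₂ →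
      ∀ [NeZero (W₁.conductorNorm ℤ)] [NeZero (W₂.conductorNorm ℤ)]
        (f₁ : CuspForm (Gamma0 (W₁.conductorNorm ℤ)) 2), IsNewformOf W₁ f₁ →
      ∀ (f₂ : CuspForm (Gamma0 (W₂.conductorNorm ℤ)) 2), IsNewformOf W₂ f₂ →
      ∀ G₁ G₂ : IwasawaAlgebra 2, IsEvenBranchLiftAtTwo W₁ f₁ G₁ → IsEvenBranchLiftAtTwo W₂ f₂ G₂ →
        lam G₁ + ∑ ℓ ∈ (W₁.conductorNorm ℤ * W₂.conductorNorm ℤ).primeFactors.erase 2, lambdaCorrectionAtTwo W₁ ℓ =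
          lam G₂ + ∑ ℓ ∈ (W₁.conductorNorm ℤ * W₂.conductorNorm ℤ).primeFactors.erase 2, lambdaCorrectionAtTwo W₂ ℓ :=
  lamLawDeltaPos_of_facts (heckeSideAtTwo_of_bz hBz).1 hBz hΩu hmod hNS hJ

/-- **The equal-conductor `λ`-law of the `Δ > 0` residual (R1) from FIVE named PRINT facts** (Buzzard 2.4, the plus period unit, modularity, the Néron
mapping property, T1 `nonempty_modularJacobianGaloisData`; any embedding `ι`): att-p4 g13's `lamLawDeltaPos_of_conductorNorm_eq_of_facts` (p671167) with the
Hecke self-duality input supplied by the tree theorem. Conclusion = that of `stub_lamLawDeltaPos`.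
[cite: GreenbergVatsal2000, Thm. (1.4)] [cite: Buzzard2000LevelLoweringModTwo, Prop. 2.4] [cite: DarmonDiamondTaylor1995, §1.5, §1.7 and Lemma 1.38]
[cite: AbbesUllmo1996, Thm. A] -/
theorem lamLawDeltaPos_of_conductorNorm_eq_of_facts_of_bz
    -- PRINT (all tree-named facts)
    (hBz : buzzard2000_multiplicityOne_gamma0) (hΩu : realPeriodRat_eq_unit_mul_plusPeriod_two)
    (hmod : exists_isNewformOf) (hNS : integral_neronScaling_of_isGloballyMinimal) (hT1 : nonempty_modularJacobianGaloisData)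
    (ι : AlgebraicClosure ℚ →+* ℂ)
    -- the pair (binders of `stub_lamLawDeltaPos` that are used)
    (W₁ : WeierstrassCurve ℚ) [W₁.IsElliptic] [W₁.IsGloballyMinimal]
    (W₂ : WeierstrassCurve ℚ) [W₂.IsElliptic] [W₂.IsGloballyMinimal]
    (hord₁ : IsOrdinaryAt W₁ 2) (hord₂ : IsOrdinaryAt W₂ 2)
    (ht₁ : ∀ x : ℚ, ¬ HasRationalTwoTorsionX W₁ x) (ht₂ : ∀ x : ℚ, ¬ HasRationalTwoTorsionX W₂ x)
    (hsq₂ : ¬ IsSquare W₂.Δ) (hK : ¬ OnKilfordStratumAtTwo W₁) (hΔ : 0 < W₁.Δ)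
    {F : Type} [Field F] [NumberField F] (hF : finrank ℚ F = 3)
    {e₁ e₂ : F} (he₁ : aeval e₁ (twoDivisionUCubic W₁) = 0) (he₂ : aeval e₂ (twoDivisionUCubic W₂) = 0)
    (hal : AlignedAtInfinity F (twoDivisionUCubic W₁) (twoDivisionUCubic W₂) e₁ e₂)
    [NeZero (W₁.conductorNorm ℤ)] [NeZero (W₂.conductorNorm ℤ)]
    {f₁ : CuspForm (Gamma0 (W₁.conductorNorm ℤ)) 2} (hf₁ : IsNewformOf W₁ f₁)
    {f₂ : CuspForm (Gamma0 (W₂.conductorNorm ℤ)) 2} (hf₂ : IsNewformOf W₂ f₂)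
    {G₁ G₂ : IwasawaAlgebra 2} (hG₁ : IsEvenBranchLiftAtTwo W₁ f₁ G₁) (hG₂ : IsEvenBranchLiftAtTwo W₂ f₂ G₂)
    -- EQUAL CONDUCTORS
    (hN : W₁.conductorNorm ℤ = W₂.conductorNorm ℤ) :
    lam G₁ + ∑ ℓ ∈ (W₁.conductorNorm ℤ * W₂.conductorNorm ℤ).primeFactors.erase 2, lambdaCorrectionAtTwo W₁ ℓ =
      lam G₂ + ∑ ℓ ∈ (W₁.conductorNorm ℤ * W₂.conductorNorm ℤ).primeFactors.erase 2, lambdaCorrectionAtTwo W₂ ℓ :=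
  lamLawDeltaPos_of_conductorNorm_eq_of_facts (heckeSideAtTwo_of_bz hBz).1 hBz hΩu hmod hNS hT1 ι W₁ W₂ hord₁ hord₂ ht₁ ht₂ hsq₂ hK hΔ hF he₁ he₂
    hal hf₁ hf₂ hG₁ hG₂ hN

end Summit.BirchSwinnertonDyer.BirchSwinnertonDyer.Theorems.AlignedTransportAtTwoSdFold

end
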